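import Mathlib

/-!
# Clause 13-R, route (ii′) item (a), part 1: the SLIP-TERM ADJOINT IDENTITY on the tangency balls
# (crux `Clause13RNearStraightL`, stmt-NavierStokesRegularity-23612; line `rate_bordered_split`, STUB R `stub_rateRow13RFlat`)

Route `FilamentSkeletonRss`, Variant A1R.  The duality interface `…Clause13RCokernelCertificate` (hand fsrs-8-g1, census item (e))
reduces the registered STUB R to a cokernel certificate `ψ` whose defining property is the EXACT ANNIHILATION
`Σ_j ∫_{S_j} ⟪ψ_j, DT·Y_j⟫ = 0` on the tangency balls `S_j = {τ : ‖X_j τ‖ ≤ R_b√(Γ log Γ)}` for every clamped admissible `Y`.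
Census item (a) of memo STRUCTURE-23612-conformal-cokernel-leafhand8-g1.md is the clause-level PAIRING IDENTITY
`Σ_j ∫_{S_j} ⟪ψ_j, DT·Y_j⟫ = Σ_k ∫_{S_k} ⟪(DT)^*ψ_k, Y_k⟫` that turns exact annihilation into the adjoint equation `(DT)^*ψ = 0`.
By the closed form `…Clause13LinearisedMapClauses.deriv_linearisedMap_inBall`, `DT·Y_j(τ)` is the sum of a nonlocal Biot–Savart part,
a local zeroth-order part, and the LOCAL FIRST-ORDER SLIP PART `(w_j τ ⟪X_j′τ, Y_j′τ⟫) X_j′τ − w_j τ Y_j′τ` (the crux's own slip `w_j`).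
THIS FILE is the adjoint identity for the slip part — the only place where a derivative of `Y` must be moved onto `ψ` in `τ`:

* §1 clamped fields: a test field that vanishes at every off-ball station vanishes with its derivative off the ball
  (`eq_zero_of_not_mem_ball`, `deriv_eq_zero_of_not_mem_ball`) and has compact support when the ball is compact
  (`hasCompactSupport_of_ball`; compactness of the ball is `Clause13RCokernelCertificate.isCompact_ball_of_cocompact`, clause 3 —
  taken here as a hypothesis so that this file imports Mathlib only, route-independent);
* §2 `integral_inner_deriv_eq_neg` — integration by parts on the line against a clamped `C¹` field for a differentiable weight `G` whose
  derivative is only dominated by a continuous function (the slip `w_j` is differentiable with `|w_j′| ≤ Λ`, NOT `C¹`, in the clause block);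
* §3 the derivative of the normal projection `Q = ψ − ⟪ψ, X′⟫X′` of a `C¹` weight along a `C²` axis and of the slip field `G = w•Q`;
* §4 **`setIntegral_inner_slip_eq`** — for `X ∈ C²`, `w` differentiable with `|w′| ≤ Λ`, `ψ ∈ C¹`, `Y ∈ C¹` vanishing off a compact ball:
  `∫_{S} ⟪ψ, (w⟪X′,Y′⟫)X′ − wY′⟫ = ∫_{S} ⟪w′•Q + w•Q′, Y⟫`, and, against NORMAL fields (`⟪Y, X′⟫ = 0`), the normal form
  `∫_{S} ⟪ψ, (w⟪X′,Y′⟫)X′ − wY′⟫ = ∫_{S} (w′⟪ψ, Y⟫ + w(⟪ψ′, Y⟫ − ⟪ψ, X′⟫⟪X″, Y⟫))` (`setIntegral_inner_slip_eq_normal`):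
  the slip part of `(DT)^*` is `ψ ↦ P_n(w′ψ + wψ′) − w⟪ψ, X′⟫X″` — first order, with the stagnation zero of `w` at the waist.

All statements are per filament with a generic ball radius `ℓ` (instantiate `ℓ := R_b√(Γ log Γ)`, `X := X j`, `w := w j`, `Y := Y j`).
Hand `leafhand-ns-filamentskeletonrs-10-g0` (LAND-ONLY); `--supports stmt-NavierStokesRegularity-23612` helper.  HONEST FRAMING: one-dimensional
calculus for the clause-level pairing at a HYPOTHETICAL near-straight filament skeleton on the NEGATIVE side of a MODEL blow-up route; STUB R is NOT
proved here and nothing in this file bears on Navier–Stokes regularity or blow-up.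
-/

noncomputable section

open MeasureTheory Filter Topology Set
open scoped RealInnerProductSpace InnerProductSpace

namespace Summit.NavierStokesRegularity.NavierStokesRegularity.Theorems.Clause13RSlipAdjoint
set_option linter.dupNamespace false

/-! ## §1 Clamped test fields -/

/-- A field vanishing at every off-ball station `ℓ < ‖X τ‖` vanishes on the complement of the ball `{τ : ‖X τ‖ ≤ ℓ}`. [folklore] -/
theorem eq_zero_of_not_mem_ball {X Y : ℝ → EuclideanSpace ℝ (Fin 3)} {ℓ : ℝ}
    (hYoff : ∀ τ, ℓ < ‖X τ‖ → Y τ = 0) {τ : ℝ} (hτ : τ ∉ {σ : ℝ | ‖X σ‖ ≤ ℓ}) : Y τ = 0 :=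
  hYoff τ (not_le.1 hτ)

/-- … and so does its derivative: the complement of the ball is open, so the field is eventually zero near every off-ball station. [folklore] -/
theorem deriv_eq_zero_of_not_mem_ball {X Y : ℝ → EuclideanSpace ℝ (Fin 3)} {ℓ : ℝ} (hXc : Continuous X)
    (hYoff : ∀ τ, ℓ < ‖X τ‖ → Y τ = 0) {τ : ℝ} (hτ : τ ∉ {σ : ℝ | ‖X σ‖ ≤ ℓ}) : deriv Y τ = 0 := by
  have hopen : IsOpen {σ : ℝ | ℓ < ‖X σ‖} := isOpen_lt continuous_const (continuous_norm.comp hXc)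
  have hmem : ℓ < ‖X τ‖ := not_le.1 hτ
  have hev : Y =ᶠ[𝓝 τ] fun _ => (0 : EuclideanSpace ℝ (Fin 3)) :=
    Filter.eventually_of_mem (hopen.mem_nhds hmem) fun σ hσ => hYoff σ hσ
  rw [hev.deriv_eq, deriv_const]

/-- A field vanishing off a compact ball has compact support. [folklore] -/
theorem hasCompactSupport_of_ball {X Y : ℝ → EuclideanSpace ℝ (Fin 3)} {ℓ : ℝ} (hS : IsCompact {σ : ℝ | ‖X σ‖ ≤ ℓ})
    (hYoff : ∀ τ, ℓ < ‖X τ‖ → Y τ = 0) : HasCompactSupport Y :=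
  HasCompactSupport.of_support_subset_isCompact hS fun τ hτ => by
    by_contra h
    exact hτ (hYoff τ (not_le.1 h))

/-- The set integral over the ball of a function vanishing off the ball is its integral over the line. [folklore] -/
theorem setIntegral_ball_eq_integral {X : ℝ → EuclideanSpace ℝ (Fin 3)} {ℓ : ℝ} {f : ℝ → ℝ}
    (hf : ∀ τ, τ ∉ {σ : ℝ | ‖X σ‖ ≤ ℓ} → f τ = 0) :
    ∫ τ in {σ : ℝ | ‖X σ‖ ≤ ℓ}, f τ = ∫ τ, f τ :=
  setIntegral_eq_integral_of_forall_compl_eq_zero hf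

/-! ## §2 Integration by parts on the line against a clamped field -/

/-- **Integration by parts against a clamped field.**  `G` differentiable with `‖G′‖` dominated by a continuous function, `Y ∈ C¹` with compact
support: `∫ ⟪G, Y′⟫ = −∫ ⟪G′, Y⟫`.  (The weight is NOT assumed `C¹`: the crux's slip is only differentiable with `|w′| ≤ Λ`.) [folklore] -/
theorem integral_inner_deriv_eq_neg {G Y : ℝ → EuclideanSpace ℝ (Fin 3)} {B : ℝ → ℝ}
    (hG : Differentiable ℝ G) (hB : Continuous B) (hGB : ∀ τ, ‖deriv G τ‖ ≤ B τ)
    (hY : ContDiff ℝ 1 Y) (hYc : HasCompactSupport Y) :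
    ∫ τ, ⟪G τ, deriv Y τ⟫ = - ∫ τ, ⟪deriv G τ, Y τ⟫ := by
  have hGc : Continuous G := hG.continuous
  have hYd : Differentiable ℝ Y := hY.differentiable (by simp)
  have hYcont : Continuous Y := hY.continuous
  have hY'c : Continuous (deriv Y) := hY.continuous_deriv le_rfl
  have hY'cs : HasCompactSupport (deriv Y) := hYc.deriv
  -- (1) `⟪G, Y′⟫` is continuous with compact support
  have h1 : Integrable fun τ => ⟪G τ, deriv Y τ⟫ := by
    refine (hGc.inner hY'c).integrable_of_hasCompactSupport ?_
    refine HasCompactSupport.intro hY'cs fun τ hτ => ?_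
    rw [image_eq_zero_of_notMem_tsupport hτ, inner_zero_right]
  -- (2) `⟪G′, Y⟫` is bounded and measurable on the compact support of `Y`, zero outside
  have h2 : Integrable fun τ => ⟪deriv G τ, Y τ⟫ := by
    have hK : IsCompact (tsupport Y) := hYc
    have hsupp : Function.support (fun τ => ⟪deriv G τ, Y τ⟫) ⊆ tsupport Y := by
      intro τ hτ
      apply subset_tsupport
      intro hY0
      exact hτ (by simp [hY0])
    rw [← integrableOn_iff_integrable_of_support_subset hsupp]
    have hBY : Continuous fun τ => B τ * ‖Y τ‖ := hB.mul hYcont.norm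
    obtain ⟨C, hC⟩ := hK.exists_bound_of_continuousOn hBY.continuousOn
    refine IntegrableOn.of_bound hK.measure_lt_top ?_ C ?_
    · exact ((stronglyMeasurable_deriv G).inner hYcont.stronglyMeasurable).aestronglyMeasurable
    · refine ae_restrict_of_forall_mem (isClosed_tsupport Y).measurableSet fun τ hτ => ?_
      have hb := hC τ hτ
      rw [Real.norm_eq_abs, abs_of_nonneg (mul_nonneg ((norm_nonneg _).trans (hGB τ)) (norm_nonneg _))] at hb
      calc ‖⟪deriv G τ, Y τ⟫‖ ≤ ‖deriv G τ‖ * ‖Y τ‖ := norm_inner_le_norm _ _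
        _ ≤ B τ * ‖Y τ‖ := mul_le_mul_of_nonneg_right (hGB τ) (norm_nonneg _)
        _ ≤ C := hb
  -- (3) `⟪G, Y⟫` is continuous with compact support
  have h3 : Integrable fun τ => ⟪G τ, Y τ⟫ := by
    refine (hGc.inner hYcont).integrable_of_hasCompactSupport ?_
    refine HasCompactSupport.intro hYc fun τ hτ => ?_
    rw [image_eq_zero_of_notMem_tsupport hτ, inner_zero_right]
  -- fundamental theorem of calculus on the line for `h = ⟪G, Y⟫`
  have hderiv : ∀ τ, HasDerivAt (fun t => ⟪G t, Y t⟫) (⟪G τ, deriv Y τ⟫ + ⟪deriv G τ, Y τ⟫) τ :=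
    fun τ => ((hG τ).hasDerivAt).inner ℝ ((hYd τ).hasDerivAt)
  have h12 : Integrable fun τ => ⟪G τ, deriv Y τ⟫ + ⟪deriv G τ, Y τ⟫ := h1.add h2
  have h0 := integral_eq_zero_of_hasDerivAt_of_integrable hderiv h12 h3
  rw [integral_add h1 h2] at h0
  linarith

/-! ## §3 The normal projection of the weight and the slip field -/

/-- Derivative of the normal projection `Q = ψ − ⟪ψ, X′⟫X′` of a `C¹` weight along a `C²` axis:
`Q′ = ψ′ − (⟪ψ′, X′⟫ + ⟪ψ, X″⟫)X′ − ⟪ψ, X′⟫X″`. [folklore] -/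
theorem hasDerivAt_proj {X ψ : ℝ → EuclideanSpace ℝ (Fin 3)} (hX : ContDiff ℝ 2 X) (hψ : ContDiff ℝ 1 ψ) (τ : ℝ) :
    HasDerivAt (fun σ => ψ σ - ⟪ψ σ, deriv X σ⟫ • deriv X σ)
      (deriv ψ τ - (⟪deriv ψ τ, deriv X τ⟫ + ⟪ψ τ, deriv (deriv X) τ⟫) • deriv X τ
        - ⟪ψ τ, deriv X τ⟫ • deriv (deriv X) τ) τ := by
  have hX1 : ContDiff ℝ 1 (deriv X) := by
    have h2 : ContDiff ℝ (1 + 1) X := by rw [one_add_one_eq_two]; exact hX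
    exact h2.deriv'
  have h1 : HasDerivAt ψ (deriv ψ τ) τ := ((hψ.differentiable (by simp)) τ).hasDerivAt
  have h2 : HasDerivAt (deriv X) (deriv (deriv X) τ) τ := ((hX1.differentiable (by simp)) τ).hasDerivAt
  have h3 : HasDerivAt (fun σ => ⟪ψ σ, deriv X σ⟫) (⟪deriv ψ τ, deriv X τ⟫ + ⟪ψ τ, deriv (deriv X) τ⟫) τ := by
    have h := h1.inner ℝ h2
    rw [add_comm] at h
    exact h
  have h4 := h1.sub (h3.smul h2)
  refine (h4.congr_deriv ?_).congr_of_eventuallyEq (Eventually.of_forall fun σ => rfl)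
  abel

/-- Derivative of the slip field `G = w • Q` for a differentiable slip `w`: `G′ = w′•Q + w•Q′`. [folklore] -/
theorem hasDerivAt_slipField {X ψ : ℝ → EuclideanSpace ℝ (Fin 3)} {w : ℝ → ℝ} (hX : ContDiff ℝ 2 X) (hψ : ContDiff ℝ 1 ψ)
    (hw : Differentiable ℝ w) (τ : ℝ) :
    HasDerivAt (fun σ => w σ • (ψ σ - ⟪ψ σ, deriv X σ⟫ • deriv X σ))
      (deriv w τ • (ψ τ - ⟪ψ τ, deriv X τ⟫ • deriv X τ)
        + w τ • (deriv ψ τ - (⟪deriv ψ τ, deriv X τ⟫ + ⟪ψ τ, deriv (deriv X) τ⟫) • deriv X τ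
            - ⟪ψ τ, deriv X τ⟫ • deriv (deriv X) τ)) τ := by
  have h := ((hw τ).hasDerivAt).smul (hasDerivAt_proj hX hψ τ)
  exact (h.congr_deriv (add_comm _ _)).congr_of_eventuallyEq (Eventually.of_forall fun σ => rfl)

/-- The slip field is differentiable. [folklore] -/
theorem differentiable_slipField {X ψ : ℝ → EuclideanSpace ℝ (Fin 3)} {w : ℝ → ℝ} (hX : ContDiff ℝ 2 X) (hψ : ContDiff ℝ 1 ψ)
    (hw : Differentiable ℝ w) :
    Differentiable ℝ (fun σ => w σ • (ψ σ - ⟪ψ σ, deriv X σ⟫ • deriv X σ)) :=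
  fun τ => (hasDerivAt_slipField hX hψ hw τ).differentiableAt

/-- Its derivative, as a `deriv`. [folklore] -/
theorem deriv_slipField {X ψ : ℝ → EuclideanSpace ℝ (Fin 3)} {w : ℝ → ℝ} (hX : ContDiff ℝ 2 X) (hψ : ContDiff ℝ 1 ψ)
    (hw : Differentiable ℝ w) (τ : ℝ) :
    deriv (fun σ => w σ • (ψ σ - ⟪ψ σ, deriv X σ⟫ • deriv X σ)) τ
      = deriv w τ • (ψ τ - ⟪ψ τ, deriv X τ⟫ • deriv X τ)
        + w τ • (deriv ψ τ - (⟪deriv ψ τ, deriv X τ⟫ + ⟪ψ τ, deriv (deriv X) τ⟫) • deriv X τ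
            - ⟪ψ τ, deriv X τ⟫ • deriv (deriv X) τ) :=
  (hasDerivAt_slipField hX hψ hw τ).deriv

/-- A continuous dominating function for `‖G′‖` when `|w′| ≤ Λ`:
`‖G′ τ‖ ≤ Λ‖Q τ‖ + |w τ|·‖Q′ τ‖`. [folklore] -/
theorem norm_deriv_slipField_le {X ψ : ℝ → EuclideanSpace ℝ (Fin 3)} {w : ℝ → ℝ} {Λ : ℝ} (hX : ContDiff ℝ 2 X) (hψ : ContDiff ℝ 1 ψ)
    (hw : Differentiable ℝ w) (hwΛ : ∀ τ, |deriv w τ| ≤ Λ) (τ : ℝ) :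
    ‖deriv (fun σ => w σ • (ψ σ - ⟪ψ σ, deriv X σ⟫ • deriv X σ)) τ‖
      ≤ Λ * ‖ψ τ - ⟪ψ τ, deriv X τ⟫ • deriv X τ‖
        + |w τ| * ‖deriv ψ τ - (⟪deriv ψ τ, deriv X τ⟫ + ⟪ψ τ, deriv (deriv X) τ⟫) • deriv X τ
            - ⟪ψ τ, deriv X τ⟫ • deriv (deriv X) τ‖ := by
  rw [deriv_slipField hX hψ hw τ]
  refine (norm_add_le _ _).trans (add_le_add ?_ ?_)
  · rw [norm_smul, Real.norm_eq_abs]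
    exact mul_le_mul_of_nonneg_right (hwΛ τ) (norm_nonneg _)
  · rw [norm_smul, Real.norm_eq_abs]

/-! ## §4 The slip-term adjoint identity on the ball -/

/-- Pointwise algebra: `⟪ψ, (w⟪X′, Y′⟫)X′ − wY′⟫ = −⟪w•(ψ − ⟪ψ, X′⟫X′), Y′⟫`. [folklore] -/
theorem inner_slip_eq_neg_inner_slipField (ψ t y' : EuclideanSpace ℝ (Fin 3)) (w : ℝ) :
    ⟪ψ, (w * ⟪t, y'⟫) • t - w • y'⟫ = - ⟪w • (ψ - ⟪ψ, t⟫ • t), y'⟫ := by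
  rw [inner_sub_right, inner_smul_right, inner_smul_right, inner_smul_left, inner_sub_left, inner_smul_left]
  simp only [conj_trivial]
  ring

/-- **THE SLIP-TERM ADJOINT IDENTITY ON THE TANGENCY BALL.**  `X ∈ C²` (clause 3), `w` differentiable with `|w′| ≤ Λ` (clause 3 and the
near-straight conclusion (ii)), a `C¹` weight `ψ`, and a clamped `C¹` test field `Y` (zero at every off-ball station; the ball compact):
`∫_S ⟪ψ, (w⟪X′,Y′⟫)X′ − wY′⟫ = ∫_S ⟪w′•Q + w•Q′, Y⟫` with `Q = ψ − ⟪ψ, X′⟫X′`. [folklore] -/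
theorem setIntegral_inner_slip_eq {X ψ Y : ℝ → EuclideanSpace ℝ (Fin 3)} {w : ℝ → ℝ} {Λ ℓ : ℝ}
    (hX : ContDiff ℝ 2 X) (hw : Differentiable ℝ w) (hwΛ : ∀ τ, |deriv w τ| ≤ Λ) (hψ : ContDiff ℝ 1 ψ)
    (hY : ContDiff ℝ 1 Y) (hS : IsCompact {σ : ℝ | ‖X σ‖ ≤ ℓ}) (hYoff : ∀ τ, ℓ < ‖X τ‖ → Y τ = 0) :
    ∫ τ in {σ : ℝ | ‖X σ‖ ≤ ℓ}, ⟪ψ τ, (w τ * ⟪deriv X τ, deriv Y τ⟫) • deriv X τ - w τ • deriv Y τ⟫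
      = ∫ τ in {σ : ℝ | ‖X σ‖ ≤ ℓ}, ⟪deriv w τ • (ψ τ - ⟪ψ τ, deriv X τ⟫ • deriv X τ)
          + w τ • (deriv ψ τ - (⟪deriv ψ τ, deriv X τ⟫ + ⟪ψ τ, deriv (deriv X) τ⟫) • deriv X τ
              - ⟪ψ τ, deriv X τ⟫ • deriv (deriv X) τ), Y τ⟫ := by
  have hXc : Continuous X := hX.continuous
  set G : ℝ → EuclideanSpace ℝ (Fin 3) := fun σ => w σ • (ψ σ - ⟪ψ σ, deriv X σ⟫ • deriv X σ) with hG
  -- both integrands vanish off the ball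
  have hL : ∀ τ, τ ∉ {σ : ℝ | ‖X σ‖ ≤ ℓ} →
      ⟪ψ τ, (w τ * ⟪deriv X τ, deriv Y τ⟫) • deriv X τ - w τ • deriv Y τ⟫ = 0 := by
    intro τ hτ
    rw [deriv_eq_zero_of_not_mem_ball hXc hYoff hτ]
    simp
  have hR : ∀ τ, τ ∉ {σ : ℝ | ‖X σ‖ ≤ ℓ} → ⟪deriv G τ, Y τ⟫ = 0 := by
    intro τ hτ
    rw [eq_zero_of_not_mem_ball hYoff hτ, inner_zero_right]
  -- the right-hand integrand is `⟪G′, Y⟫`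
  have hRHS : (fun τ => ⟪deriv w τ • (ψ τ - ⟪ψ τ, deriv X τ⟫ • deriv X τ)
          + w τ • (deriv ψ τ - (⟪deriv ψ τ, deriv X τ⟫ + ⟪ψ τ, deriv (deriv X) τ⟫) • deriv X τ
              - ⟪ψ τ, deriv X τ⟫ • deriv (deriv X) τ), Y τ⟫) = fun τ => ⟪deriv G τ, Y τ⟫ := by
    funext τ; rw [hG, deriv_slipField hX hψ hw τ]
  have hLHS : (fun τ => ⟪ψ τ, (w τ * ⟪deriv X τ, deriv Y τ⟫) • deriv X τ - w τ • deriv Y τ⟫)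
      = fun τ => - ⟪G τ, deriv Y τ⟫ := by
    funext τ; rw [inner_slip_eq_neg_inner_slipField]
  rw [hRHS, setIntegral_eq_integral_of_forall_compl_eq_zero hL, setIntegral_eq_integral_of_forall_compl_eq_zero hR, hLHS,
    integral_neg]
  -- integration by parts on the line
  have hcont : Continuous fun τ => Λ * ‖ψ τ - ⟪ψ τ, deriv X τ⟫ • deriv X τ‖
      + |w τ| * ‖deriv ψ τ - (⟪deriv ψ τ, deriv X τ⟫ + ⟪ψ τ, deriv (deriv X) τ⟫) • deriv X τ
          - ⟪ψ τ, deriv X τ⟫ • deriv (deriv X) τ‖ := by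
    have hX1 : ContDiff ℝ 1 (deriv X) := by
      have h2 : ContDiff ℝ (1 + 1) X := by rw [one_add_one_eq_two]; exact hX
      exact h2.deriv'
    have c1 : Continuous (deriv X) := hX1.continuous
    have c2 : Continuous (deriv (deriv X)) := hX1.continuous_deriv le_rfl
    have c3 : Continuous ψ := hψ.continuous
    have c4 : Continuous (deriv ψ) := hψ.continuous_deriv le_rfl
    have c5 : Continuous w := hw.continuous
    have i31 : Continuous fun τ => ⟪ψ τ, deriv X τ⟫ := c3.inner c1
    have i41 : Continuous fun τ => ⟪deriv ψ τ, deriv X τ⟫ := c4.inner c1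
    have i32 : Continuous fun τ => ⟪ψ τ, deriv (deriv X) τ⟫ := c3.inner c2
    have cQ : Continuous fun τ => ψ τ - ⟪ψ τ, deriv X τ⟫ • deriv X τ := c3.sub (i31.smul c1)
    have cQ' : Continuous fun τ => deriv ψ τ - (⟪deriv ψ τ, deriv X τ⟫ + ⟪ψ τ, deriv (deriv X) τ⟫) • deriv X τ
        - ⟪ψ τ, deriv X τ⟫ • deriv (deriv X) τ :=
      (c4.sub ((i41.add i32).smul c1)).sub (i31.smul c2)
    exact (continuous_const.mul cQ.norm).add (c5.abs.mul cQ'.norm)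
  rw [integral_inner_deriv_eq_neg (differentiable_slipField hX hψ hw) hcont (norm_deriv_slipField_le hX hψ hw hwΛ) hY
    (hasCompactSupport_of_ball hS hYoff), neg_neg]

/-- **NORMAL FORM against normal test fields.**  If moreover `⟪Y τ, X′τ⟫ = 0` for all `τ` (the admissible class), the `X′`-components of
`(w•Q)′` drop out: `∫_S ⟪ψ, (w⟪X′,Y′⟫)X′ − wY′⟫ = ∫_S (w′⟪ψ, Y⟫ + w(⟪ψ′, Y⟫ − ⟪ψ, X′⟫⟪X″, Y⟫))`, i.e. the slip part of the adjoint
operator is `ψ ↦ P_n(w′ψ + wψ′) − w⟪ψ, X′⟫X″`. [folklore] -/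
theorem setIntegral_inner_slip_eq_normal {X ψ Y : ℝ → EuclideanSpace ℝ (Fin 3)} {w : ℝ → ℝ} {Λ ℓ : ℝ}
    (hX : ContDiff ℝ 2 X) (hw : Differentiable ℝ w) (hwΛ : ∀ τ, |deriv w τ| ≤ Λ) (hψ : ContDiff ℝ 1 ψ)
    (hY : ContDiff ℝ 1 Y) (hS : IsCompact {σ : ℝ | ‖X σ‖ ≤ ℓ}) (hYoff : ∀ τ, ℓ < ‖X τ‖ → Y τ = 0)
    (hYn : ∀ τ, ⟪Y τ, deriv X τ⟫ = 0) :
    ∫ τ in {σ : ℝ | ‖X σ‖ ≤ ℓ}, ⟪ψ τ, (w τ * ⟪deriv X τ, deriv Y τ⟫) • deriv X τ - w τ • deriv Y τ⟫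
      = ∫ τ in {σ : ℝ | ‖X σ‖ ≤ ℓ}, (deriv w τ * ⟪ψ τ, Y τ⟫
          + w τ * (⟪deriv ψ τ, Y τ⟫ - ⟪ψ τ, deriv X τ⟫ * ⟪deriv (deriv X) τ, Y τ⟫)) := by
  rw [setIntegral_inner_slip_eq hX hw hwΛ hψ hY hS hYoff]
  refine integral_congr_ae (Eventually.of_forall fun τ => ?_)
  have hn : ⟪deriv X τ, Y τ⟫ = 0 := by rw [real_inner_comm]; exact hYn τ
  simp only [inner_add_left, inner_sub_left, inner_smul_left, conj_trivial, hn, mul_zero, sub_zero]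

end Summit.NavierStokesRegularity.NavierStokesRegularity.Theorems.Clause13RSlipAdjoint

end
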